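import Literature.Computability.Complexity.LazySamplingCount
import Literature.Computability.Complexity.UniformProbBlocks
import HarnessLib

/-!
# Lazy sampling of a random oracle, III: the query bound and the probability form

Continuation of `LazySampling.lean` / `LazySamplingCount.lean`. The finite set
`queryBound M x k F ⊇ F` of all strings `M` can query on `x` within `k` rounds against
single-bit answers (there are finitely many bit transcripts of length `< k`, `bitTranscripts`),
and the counting identity rewritten with G01's counting probability `uniformProb`
(`Randomized.lean`, counted over `Fin k → Bool` by `uniformProb_eq_card_fun` of `UniformProbBlocks.lean`): **`uniformProb_lazySampling`** — the probability over coin strings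
`y ∈ {0,1}^k` that the lazy-sampling simulation outputs `b` within `k` rounds equals the
fraction of tables on `queryBound M x k F` agreeing with `τ` against which `M` outputs `b`.
(The identification of that fraction with the conditional random-oracle measure
`μ(· | cylinder of τ)` uses `QuantumComplexity/RandomOracleCylinders.lean` and is made where the
two are combined.)

## References

* C. H. Bennett, J. Gill, SIAM J. Comput. 10 (1981) 96–113 [BennettGill1981].
* R. V. Book, H. Vollmer, K. W. Wagner, ICALP 1996, LNCS 1099 [BookVollmerWagner1996], §3
  Prop. 1–2 (p. 373–374).
-/

namespace Literature.Computability.Complexity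

open _root_.Computability

namespace OracleAlg

variable {β : Type} (M : OracleAlg β) (x : List Bool)

/-! ### A finite set containing all possible queries -/

section QueryBound

/-- The bit transcripts of length `< k`. [folklore] -/
def bitTranscripts (k : ℕ) : Finset (List (List Bool)) :=
  (Finset.range k).biUnion fun n =>
    (Finset.univ : Finset (Fin n → Bool)).image fun g => List.ofFn fun i => [g i]

/-- A list of `< k` single bits is a bit transcript. [folklore] -/
theorem mem_bitTranscripts {k : ℕ} {as : List (List Bool)} (hlen : as.length < k)
    (hbits : ∀ a ∈ as, ∃ c : Bool, a = [c]) : as ∈ bitTranscripts k := by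
  classical
  simp only [bitTranscripts, Finset.mem_biUnion, Finset.mem_range, Finset.mem_image,
    Finset.mem_univ, true_and]
  refine ⟨as.length, hlen, fun i => (as[i]).headD false, ?_⟩
  apply List.ext_getElem
  · simp
  · intro i h1 h2
    obtain ⟨c, hc⟩ := hbits _ (List.getElem_mem h2)
    simp only [List.getElem_ofFn]
    change [as[i].headD false] = as[i]
    rw [hc]; rfl

/-- All queries `M` can ask on `x` within `k` rounds against single-bit answers, together with `F`. [folklore] -/
def queryBound (k : ℕ) (F : Finset (List Bool)) : Finset (List Bool) :=
  F ∪ (bitTranscripts k).biUnion fun as =>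
    match M.step x as with
    | Sum.inl u => {u}
    | Sum.inr _ => ∅

/-- The query bound contains the table's domain. [folklore] -/
theorem subset_queryBound (k : ℕ) (F : Finset (List Bool)) : F ⊆ queryBound M x k F :=
  Finset.subset_union_left

/-- The query bound contains every query asked within `k` rounds against bit answers. [folklore] -/
theorem mem_queryBound {k : ℕ} (F : Finset (List Bool)) {as : List (List Bool)} {u : List Bool}
    (hlen : as.length < k) (hbits : ∀ a ∈ as, ∃ c : Bool, a = [c]) (hstep : M.step x as = Sum.inl u) :
    u ∈ queryBound M x k F := by
  classical
  refine Finset.mem_union_right _ (Finset.mem_biUnion.2 ⟨as, mem_bitTranscripts hlen hbits, ?_⟩)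
  simp [hstep]

/-- **Locality of runs**: two history-free answer rules that agree on the query bound give the
same run within `k` rounds. [cite: AroraBarak2009, §3.4] -/
theorem runWith_congr_queryBound {k : ℕ} (F : Finset (List Bool)) {O O' : List Bool → Bool}
    (h : ∀ u ∈ queryBound M x k F, O u = O' u) :
    runWith M x (fun _ u => O u) k [] = runWith M x (fun _ u => O' u) k [] := by
  rcases Nat.eq_zero_or_pos k with rfl | hk
  · rfl
  have htr : traceT M x (fun _ u => O' u) (k - 1) = traceT M x (fun _ u => O u) (k - 1) := by
    refine traceT_congr M x _ _ (k - 1) fun i hi u hu => h u ?_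
    refine mem_queryBound M x F (as := (traceT M x (fun _ u => O u) (k - 1)).take i) ?_ ?_ hu
    · rw [List.length_take_of_le hi.le]
      have := length_traceT_le M x (fun _ u => O u) (k - 1)
      omega
    · intro a ha
      exact traceT_entries M x _ (k - 1) a (List.take_subset _ _ ha)
  have key : ∀ b, runWith M x (fun _ u => O u) k [] = some b ↔ runWith M x (fun _ u => O' u) k [] = some b := by
    intro b
    rw [runWith_nil_eq_some_iff M x _ hk, runWith_nil_eq_some_iff M x _ hk, htr]
  cases h1 : runWith M x (fun _ u => O u) k [] with
  | some b => exact ((key b).1 h1).symm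
  | none =>
    cases h2 : runWith M x (fun _ u => O' u) k [] with
    | none => rfl
    | some b => exact absurd ((key b).2 h2) (by rw [h1]; simp)

end QueryBound

/-! ### The identity in terms of `uniformProb` -/

section Uniform

/-- **Lazy sampling, probability form.** The probability over coin strings `y ∈ {0,1}^k` that the
lazy-sampling simulation of `M` on `x` (table `τ` on `F`) outputs `b` within `k` rounds equals the
fraction of tables `B` on `queryBound M x k F` agreeing with `τ` against which `M` outputs `b`. [cite: BookVollmerWagner1996, §3 Prop. 1–2 (p. 373–374)] -/
theorem uniformProb_lazySampling [DecidableEq β] (k : ℕ) (F : Finset (List Bool)) (τ : F → Bool) (b : β) :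
    uniformProb k {y | runWith M x (coinAns M F τ x y) k [] = some b} =
      ((tables (queryBound M x k F) F τ).filter fun B =>
          runWith M x (fun _ u => extB (queryBound M x k F) B u) k [] = some b).card /
        (tables (queryBound M x k F) F τ).card := by
  classical
  rw [uniformProb_eq_card_fun]
  have h := lazySampling_count_run M x (τ := τ) (subset_queryBound M x k F)
    (fun as u hlen hbits hstep => mem_queryBound M x F hlen hbits hstep) b
  have hΩ : ((tables (queryBound M x k F) F τ).card : ℝ) ≠ 0 :=
    Nat.cast_ne_zero.2 (card_tables_ne_zero (subset_queryBound M x k F))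
  rw [div_eq_div_iff (by positivity) hΩ]
  simp only [Set.mem_setOf_eq]
  have := congrArg (fun n : ℕ => (n : ℝ)) h
  push_cast at this
  linarith

end Uniform

end OracleAlg

end Literature.Computability.Complexity
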